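import Summits.ABC.IUTFork.Repair.RHHullCapacityNecessaryTyped
import Literature.IUT.LogVolume.LogRadiusClosedForm
import HarnessLib

/-!
# IUT REPAIR branch → R-H (D-0079 «LOCAL-HEIGHT CONDITION I06⋆», rung LADDER-ABC:A2.RESCUE.H), ROUND 1 row 3 — `RHHullCapacityNecessaryInt`:
# H⋆₃'s cell in INTEGER CURRENCY (`decide`-able at every table row) and the CLOSED FORM of its window
# «(j−1)·m_q ≤ e_w·(B_w+2) + A_w − 2», on the λ_k family «k ≤ 2·(B_w + 2)», `B_w = ⌊log_p(p·e_w/(p−1))⌋`, `A_w = ⌈e_w/(p−2)⌉`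

PROOF + evaluation file of the abc-iut cell (D-0079 RESCUE sub-cell R-H, ROUND 1 pair n = 3: typer abc-iut-rh-typ-3 gen 2; `plan/rescue/R-H/RH-CANDIDATES.tsv`
v1 row 3 «hull-capacity-necessary», `ROUND1.tsv` row 3 word «KILL(k1) HEX-all + WINDOW-LOCATOR(HEX: k ≤ 8) = the necessary condition of record»).
TAKES NO SIDE on [IUTchIII] Cor. 3.12 or on any author; H⋆₃ (`RHHullCapacityNecessaryTyped.HStar`, p458118) is a claim-tagged HYPOTHESIS about OUR
typed objects, never asserted; typed ≠ proved; instantiated ≠ endorsed; refuted-as-typed ≠ refuted-in-print; nothing here asserts abc.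

CONTENTS. §1 the two depth constants of [IUTchIV] Prop. 1.2 as NATURAL NUMBERS: **`aWin p e`** `:= (e + p − 3)/(p − 2) = ⌈e/(p−2)⌉` and
**`bWin p e`** `:= Nat.log p (p·e/(p−1)) = ⌊log_p(p·e/(p−1))⌋` with its window `p^B·(p−1) ≤ p·e < p^{B+1}·(p−1)` (**`bWin_window`**), so that
`logRadiusA p e = aWin/e` (abc-iut-rp-x2 `logRadiusA_eq_ceilDiv`, cited BY NAME) and `logRadiusB p e = bWin − 1/e` (**`logRadiusB_eq_bWin`**, via
`logRadiusB_eq_of_window`). §2 **`IntCell p e m j`** `:= e·⌊(j²m − (j+1)(e − 1 + A))/e⌋ ≤ m + (j+1)·(e·(B+1) − 1)` (integers only; `/` = `Int.ediv`)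
and **`cellAt_pilotDataOfK_iff_intCell`**: at a place `w | p` (`p` odd, `p ∤ e(w|p) = e`, `P_q(w) = m`) of the genuine datum `pilotDataOfK D K`,
`CellAt ⟺ IntCell p e m (i₀+1)` — the k1 column of row 3 becomes a `decide` per row (this is the «certified» stamp of I06STAR-COLUMNS for row 3).
§3 CLOSED FORM: **`ClosedSuff p e m j`** `:= (j−1)·m + 2 ≤ e·(B+2) + A` ⟹ `IntCell` (**`intCell_of_closedSuff`**, floor-free: the cell's slack
is at least `(j+1)·(d + a + b + 1) − (j²−1)·μ`), hence ⟹ `CellAt` (**`cellAt_pilotDataOfK_of_closedSuff`**); on R-W's λ_k HEX family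
(`p = 7`, `e_w = e(v|7)·l`, `m_q = e(v|7)·k`, labels `j ≤ l⋆`): **`closedSuff_of_k_le`**: `k ≤ 2·(bWin 7 e_w + 2)` ⟹ `ClosedSuff` at EVERY label —
i.e. H⋆₃ holds at `w` whenever `k ≤ 6` (`e_w ≤ 41`), `k ≤ 8` (`42 ≤ e_w ≤ 293`), `k ≤ 10` (`294 ≤ e_w ≤ 2057`), `k ≤ 12` (`e_w ≥ 2058`). On the 256
G-HEX detail rows of I06STAR-COLUMNS v1 (2e4c48fd4267a5a7) this sufficient condition is EXACT (seat-side enumeration: hold ⟺ `k ≤ 2(B_w+2)`,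
149/256; the 33 failing / 887 holding decidable HEX-strip cells likewise) — the WINDOW-LOCATOR «k ≤ 8» of ROUND1.tsv row 3 is the `B_w = 2` band.
§4 KERNEL EVALUATIONS (`decide`) at the slice boundary of §8 A6: the single `k ≤ 8` failure G-HEX-k7-l41-ev1 (`B = 1`), the holds at k8-l47-ev1 and
k9-l53-ev6 (`B = 3`), the failure at k9-l53-ev5 (`B = 2`), and the genuine-datum corollary **`not_cellAt_pilotDataOfK_k7_l41_ev1`**.

HONEST SCOPE. Integer bookkeeping of abc-iut-w4-d092's explicit-depth container at realising ideles (R-W `margin_ED`); H⋆₃ holding says only that THIS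
refuting engine is silent (R-W «WINDOW»), not that the licence holds (row 3 is the NECESSARY side: `RHHullCapacityNecessaryTyped.hStar_of_licence`).
[cite: Mochizuki2012, IUTchIV Prop. 1.2 (i)(ii) p. 10; IUTchI Ex. 3.2 (iv) p. 71] [cite: SerreLocalFields1979, Ch. III §6 Prop. 13]
[claim: Mochizuki2012, status: disputed] for every IUT sentence.
-/

noncomputable section

open Set Function NumberField IsDedekindDomain
open scoped Pointwise

namespace Summit.ABC.IUTFork.Repair.RHHullCapacityNecessaryInt

open Literature.AnabelianGeometry.AbsoluteAnabelian Literature.IUT.LogThetaLattice Literature.IUT.LogVolume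
  Literature.IUT.HodgeTheaters Literature.NumberTheory.NumberFields Literature.NumberTheory.GaloisRepresentations.Ultrametric
open Summit.ABC.IUTFork.Thm311 Summit.ABC.IUTFork.Thm311.Real Summit.ABC.IUTFork.Cor312 Summit.ABC.IUTFork.Cor312.Setting
  Summit.ABC.IUTFork.Cor312Vol Summit.ABC.IUTFork.Cor312Vol.ExplicitDepth Summit.ABC.IUTFork.Cor312Prov
  Summit.ABC.IUTFork.Repair.RHHullCapacityNecessaryTyped

/-! ## §1. The depth constants `a_e`, `b_e` of [IUTchIV] Prop. 1.2 as natural numbers -/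

section Constants

/-- `A := ⌈e/(p−2)⌉ = (e + p − 3)/(p − 2)` (division in `ℕ`), the numerator of `a_e = logRadiusA p e = A/e` for odd `p`.
[cite: Mochizuki2012, IUTchIV Prop. 1.2 p. 10] -/
@[folklore]
def aWin (p e : ℕ) : ℕ := (e + (p - 3)) / (p - 2)

/-- `B := ⌊log_p(p·e/(p−1))⌋ = Nat.log p (p·e/(p−1))` (division in `ℕ`), the integer part of `b_e = logRadiusB p e = B − 1/e`.
[cite: Mochizuki2012, IUTchIV Prop. 1.2 p. 10] -/
@[folklore]
def bWin (p e : ℕ) : ℕ := Nat.log p (p * e / (p - 1))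

/-- The defining window of `B = bWin p e`: `p^B·(p−1) ≤ p·e < p^{B+1}·(p−1)`. [folklore] -/
theorem bWin_window {p e : ℕ} (hp : 1 < p) (he : 1 ≤ e) :
    p ^ bWin p e * (p - 1) ≤ p * e ∧ p * e < p ^ (bWin p e + 1) * (p - 1) := by
  have hp1 : 0 < p - 1 := by omega
  have hx : p * e / (p - 1) ≠ 0 := by
    have h1 : p - 1 ≤ p * e := le_trans (Nat.sub_le p 1) (Nat.le_mul_of_pos_right p he)
    exact (Nat.div_pos h1 hp1).ne'
  refine ⟨(Nat.le_div_iff_mul_le hp1).1 (Nat.pow_log_le_self p hx), ?_⟩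
  exact (Nat.div_lt_iff_lt_mul hp1).1 (Nat.lt_pow_succ_log_self hp _)

/-- `a_e = A/e` with `A = aWin p e` (odd `p`): abc-iut-rp-x2's `logRadiusA_eq_ceilDiv`, by name. [cite: Mochizuki2012, IUTchIV Prop. 1.2 p. 10] -/
theorem logRadiusA_eq_aWin {p e : ℕ} (hp : 2 < p) (he : 1 ≤ e) : logRadiusA p e = (aWin p e : ℝ) / e :=
  logRadiusA_eq_ceilDiv hp he

/-- `b_e = B − 1/e` with `B = bWin p e`: abc-iut-rp-x2's `logRadiusB_eq_of_window` at the window `bWin_window`.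
[cite: Mochizuki2012, IUTchIV Prop. 1.2 p. 10] -/
theorem logRadiusB_eq_bWin {p e : ℕ} (hp : 1 < p) (he : 1 ≤ e) : logRadiusB p e = (bWin p e : ℝ) - 1 / e :=
  logRadiusB_eq_of_window hp he (bWin_window hp he).1 (bWin_window hp he).2

end Constants

/-! ## §2. The cell in integer currency -/

section IntegerCell

/-- **H⋆₃'s cell in INTEGER currency** `(p, e, m, j)` (`e = e(w|p)`, `m = m_q(w) = P_q(w)`, label `j`): with `A = aWin p e`, `B = bWin p e`,
`N := j²·m − (j+1)·(e − 1 + A)`: «`e·⌊N/e⌋ ≤ m + (j+1)·(e·(B+1) − 1)`» (`/` on `ℤ` is floor division by the positive `e`). This is R-W's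
`margin_ED ≥ 0` multiplied by `e` (integer bookkeeping; the IUT reading is the bridge theorem below). [folklore] -/
@[folklore]
def IntCell (p e m j : ℕ) : Prop :=
  (e : ℤ) * ((((j ^ 2 * m : ℕ) : ℤ) - ((j + 1 : ℕ) : ℤ) * (((e : ℤ) - 1) + (aWin p e : ℤ))) / (e : ℤ)) ≤
    (m : ℤ) + ((j + 1 : ℕ) : ℤ) * ((e : ℤ) * ((bWin p e : ℤ) + 1) - 1)

variable {F K Fbar : Type} [Field F] [NumberField F] [Field K] [NumberField K] [Algebra F K] [Field Fbar]
  [Algebra F Fbar] [Algebra K Fbar] {E : WeierstrassCurve F} [E.IsElliptic] {l : ℕ} {Pb : BadPlacePredicates K}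
  (D : InitialThetaData F K Fbar E l Pb) {logv : PadicLogs K} (hlog : LogvAnalytic logv)

/-- **`CellAt ⟺ IntCell` AT A PLACE OF THE GENUINE DATUM** (`p` odd, `e(w|p) = e` with `p ∤ e`, `P_q(w) = m`, label `j = i₀+1`): the row-3 k1
column is a `decide` per row of I06STAR-COLUMNS. [cite: Mochizuki2012, IUTchI Ex. 3.2 (iv) p. 71; IUTchIV Prop. 1.2 (i)(ii) p. 10]
[claim: Mochizuki2012, status: disputed] -/
theorem cellAt_pilotDataOfK_iff_intCell (pp : Nat.Primes) (i₀ : Fin (thetaIndex (pilotDataOfK D K)).lstar)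
    (w : (thetaIndex (pilotDataOfK D K)).Fibre (.inr pp)) {e m : ℕ} (hp : 2 < (pp : ℕ))
    (hram : haveI : Fact (pp : ℕ).Prime := ⟨pp.2⟩; (placeOf (pilotDataOfK D K) pp.1 w).asIdeal.ramificationIdx ℤ = e)
    (htame : ¬ (pp : ℕ) ∣ e)
    (hP : haveI : Fact (pp : ℕ).Prime := ⟨pp.2⟩; (pilotDataOfK D K).qPilot (placeOf (pilotDataOfK D K) pp.1 w) = m) :
    haveI : Fact (pp : ℕ).Prime := ⟨pp.2⟩
    CellAt (pilotDataOfK D K) hlog pp i₀ w ↔ IntCell pp e m ((i₀ : ℕ) + 1) := by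
  haveI hF : Fact (pp : ℕ).Prime := ⟨pp.2⟩
  have he1 : 1 ≤ e := by
    rcases Nat.eq_zero_or_pos e with h | h
    · exact absurd (h ▸ dvd_zero (pp : ℕ)) htame
    · exact h
  have he0 : (0 : ℝ) < (e : ℝ) := by exact_mod_cast he1
  have hp2 : (pp : ℕ) ≠ 2 := by omega
  rw [cellAt_pilotDataOfK_iff_of_not_dvd D hlog pp i₀ w hram htame hP, logRadiusA_eq_aWin hp he1,
    logRadiusB_eq_bWin (lt_trans one_lt_two hp) he1, if_neg hp2]
  unfold IntCell
  set A : ℕ := aWin pp e with hA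
  set B : ℕ := bWin pp e with hB
  set N : ℤ := (((((i₀ : ℕ) + 1) ^ 2 * m : ℕ) : ℤ) - (((i₀ : ℕ) + 1 + 1 : ℕ) : ℤ) * (((e : ℤ) - 1) + (A : ℤ))) with hN
  set M : ℤ := (m : ℤ) + (((i₀ : ℕ) + 1 + 1 : ℕ) : ℤ) * ((e : ℤ) * ((B : ℤ) + 1) - 1) with hM
  have harg : (((i₀ : ℕ) + 1 : ℕ) : ℝ) ^ 2 * ((m : ℝ) / e) - ((i₀ : ℕ) + 2 : ℝ) * (((e : ℝ) - 1) / e + (A : ℝ) / e) =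
      ((N : ℤ) : ℝ) / (e : ℝ) := by
    rw [hN]; push_cast; field_simp; ring
  have hrhs : (m : ℝ) / e + ((i₀ : ℕ) + 2 : ℝ) * ((((1 : ℕ)) : ℝ) + ((B : ℝ) - 1 / e)) = ((M : ℤ) : ℝ) / (e : ℝ) := by
    rw [hM]; push_cast; field_simp; ring
  rw [harg, hrhs, Int.floor_div_natCast, Int.floor_intCast, le_div_iff₀ he0]
  constructor
  · intro h
    have h' : (((N / (e : ℤ)) * (e : ℤ) : ℤ) : ℝ) ≤ ((M : ℤ) : ℝ) := by push_cast; exact h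
    have h'' := Int.cast_le.1 h'
    linarith [mul_comm (N / (e : ℤ)) (e : ℤ)]
  · intro h
    have h' : (N / (e : ℤ)) * (e : ℤ) ≤ M := by linarith [mul_comm (N / (e : ℤ)) (e : ℤ)]
    have h'' : (((N / (e : ℤ)) * (e : ℤ) : ℤ) : ℝ) ≤ ((M : ℤ) : ℝ) := Int.cast_le.2 h'
    push_cast at h''; exact h''

end IntegerCell

/-! ## §3. The closed form of the window -/

section ClosedForm

/-- **CLOSED-FORM SUFFICIENT CONDITION** for the cell (floor-free): «`(j−1)·m + 2 ≤ e·(B+2) + A`», i.e. `(j−1)·μ ≤ d + a + b + 1` in the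
`ord_p` currency (`μ = m/e`, `d = (e−1)/e`, `a = A/e`, `b = B − 1/e`); integer bookkeeping. [folklore] -/
@[folklore]
def ClosedSuff (p e m j : ℕ) : Prop := (j - 1) * m + 2 ≤ e * (bWin p e + 2) + aWin p e

/-- `ClosedSuff ⟹ IntCell` (for `e ≥ 1`, `j ≥ 1`): since `e·⌊N/e⌋ ≤ N`, it suffices that `N ≤ m + (j+1)(e(B+1) − 1)`, i.e.
`(j²−1)·m ≤ (j+1)·(e(B+2) + A − 2)`, i.e. `(j−1)·m ≤ e(B+2) + A − 2`. [folklore] -/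
theorem intCell_of_closedSuff {p e m j : ℕ} (he : 1 ≤ e) (hj : 1 ≤ j) (h : ClosedSuff p e m j) : IntCell p e m j := by
  unfold ClosedSuff at h
  unfold IntCell
  set A : ℕ := aWin p e
  set B : ℕ := bWin p e
  set N : ℤ := (((j ^ 2 * m : ℕ) : ℤ) - ((j + 1 : ℕ) : ℤ) * (((e : ℤ) - 1) + (A : ℤ))) with hN
  have he0 : (0 : ℤ) < (e : ℤ) := by exact_mod_cast he
  have hfl : (e : ℤ) * (N / (e : ℤ)) ≤ N := Int.mul_ediv_self_le (ne_of_gt he0)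
  have hj' : ((j - 1 : ℕ) : ℤ) = (j : ℤ) - 1 := by push_cast [Nat.cast_sub hj]; ring
  have h' : ((j : ℤ) - 1) * (m : ℤ) + 2 ≤ (e : ℤ) * ((B : ℤ) + 2) + (A : ℤ) := by
    have := h; rw [← hj']; exact_mod_cast this
  have hj0 : (0 : ℤ) ≤ (j : ℤ) + 1 := by positivity
  have hmul : ((j : ℤ) + 1) * (((j : ℤ) - 1) * (m : ℤ) + 2) ≤ ((j : ℤ) + 1) * ((e : ℤ) * ((B : ℤ) + 2) + (A : ℤ)) :=
    mul_le_mul_of_nonneg_left h' hj0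
  have hNle : N ≤ (m : ℤ) + ((j + 1 : ℕ) : ℤ) * ((e : ℤ) * ((B : ℤ) + 1) - 1) := by
    rw [hN]; push_cast; nlinarith [hmul]
  exact le_trans hfl hNle

variable {F K Fbar : Type} [Field F] [NumberField F] [Field K] [NumberField K] [Algebra F K] [Field Fbar]
  [Algebra F Fbar] [Algebra K Fbar] {E : WeierstrassCurve F} [E.IsElliptic] {l : ℕ} {Pb : BadPlacePredicates K}
  (D : InitialThetaData F K Fbar E l Pb) {logv : PadicLogs K} (hlog : LogvAnalytic logv)

/-- **CLOSED FORM ⟹ H⋆₃'s CELL at a place of the genuine datum** (`p` odd, `p ∤ e(w|p) = e`, `P_q(w) = m`, label `j = i₀+1`):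
`(j−1)·m + 2 ≤ e·(B+2) + A ⟹ CellAt`. [claim: Mochizuki2012, status: disputed] -/
theorem cellAt_pilotDataOfK_of_closedSuff (pp : Nat.Primes) (i₀ : Fin (thetaIndex (pilotDataOfK D K)).lstar)
    (w : (thetaIndex (pilotDataOfK D K)).Fibre (.inr pp)) {e m : ℕ} (hp : 2 < (pp : ℕ))
    (hram : haveI : Fact (pp : ℕ).Prime := ⟨pp.2⟩; (placeOf (pilotDataOfK D K) pp.1 w).asIdeal.ramificationIdx ℤ = e)
    (htame : ¬ (pp : ℕ) ∣ e)
    (hP : haveI : Fact (pp : ℕ).Prime := ⟨pp.2⟩; (pilotDataOfK D K).qPilot (placeOf (pilotDataOfK D K) pp.1 w) = m)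
    (h : ClosedSuff pp e m ((i₀ : ℕ) + 1)) :
    haveI : Fact (pp : ℕ).Prime := ⟨pp.2⟩
    CellAt (pilotDataOfK D K) hlog pp i₀ w := by
  have he1 : 1 ≤ e := by
    rcases Nat.eq_zero_or_pos e with h0 | h0
    · exact absurd (h0 ▸ dvd_zero (pp : ℕ)) htame
    · exact h0
  exact (cellAt_pilotDataOfK_iff_intCell D hlog pp i₀ w hp hram htame hP).2 (intCell_of_closedSuff he1 (by omega) h)

/-- **THE λ_k-FAMILY CLOSED FORM «k ≤ 2·(B_w + 2)»**: at a place with `e = ev·l'` and `m = ev·k` (R-W's HEX local model: `e_w = e(v|7)·l`,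
`m_q = e(v|7)·ord_7(q)/2 = e(v|7)·k`), every label `j` with `2j + 1 ≤ l'` (i.e. `j ≤ l⋆`) satisfies `ClosedSuff` as soon as `k ≤ 2·(bWin p e + 2)`
and `ev ≥ 1`. (Any `p`; the bands for `p = 7` are `k ≤ 6 / 8 / 10 / 12` for `e_w ≤ 41 / ≤ 293 / ≤ 2057 / ≥ 2058`.) [folklore] -/
theorem closedSuff_of_k_le {p e m j k ev l' : ℕ} (he : e = ev * l') (hm : m = ev * k) (hev : 1 ≤ ev) (hj : 2 * j + 1 ≤ l')
    (hk : k ≤ 2 * (bWin p e + 2)) : ClosedSuff p e m j := by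
  unfold ClosedSuff
  set B : ℕ := bWin p e
  subst he hm
  have hl1 : 1 ≤ l' := by omega
  have hbase : 2 ≤ ev * l' * (B + 2) := by
    have h0 : 1 * 1 * 2 ≤ ev * l' * (B + 2) := Nat.mul_le_mul (Nat.mul_le_mul hev hl1) (by omega)
    simpa using h0
  rcases Nat.eq_zero_or_pos j with rfl | hj0
  · simp only [Nat.zero_sub, zero_mul, zero_add]
    exact le_trans hbase (Nat.le_add_right _ _)
  have h1 : (j - 1) * (ev * k) ≤ (j - 1) * (ev * (2 * (B + 2))) :=
    Nat.mul_le_mul_left _ (Nat.mul_le_mul_left _ hk)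
  have h2 : (j - 1) * (ev * (2 * (B + 2))) + 2 ≤ ev * l' * (B + 2) := by
    have hj1 : 2 * (j - 1) + 3 ≤ l' := by omega
    have h3 : (2 * (j - 1) + 3) * (ev * (B + 2)) ≤ l' * (ev * (B + 2)) := Nat.mul_le_mul_right _ hj1
    have h4 : 2 ≤ 3 * (ev * (B + 2)) := by nlinarith
    nlinarith [h3, h4]
  calc (j - 1) * (ev * k) + 2 ≤ (j - 1) * (ev * (2 * (B + 2))) + 2 := Nat.add_le_add_right h1 2
    _ ≤ ev * l' * (B + 2) := h2
    _ ≤ ev * l' * (B + 2) + aWin p (ev * l') := Nat.le_add_right _ _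

/-- **H⋆₃ AT A λ_k-MODEL PLACE OF THE GENUINE DATUM from «k ≤ 2(B_w+2)»**: if `p` is odd, `e(w|p) = ev·l'` with `p ∤ e(w|p)`, `P_q(w) = ev·k`,
every label satisfies `2(i₀+1) + 1 ≤ l'`, and `k ≤ 2·(bWin p e(w|p) + 2)`, then `CellAt` holds at EVERY label at `w`. [claim: Mochizuki2012, status: disputed] -/
theorem cellAt_pilotDataOfK_of_k_le (pp : Nat.Primes) (w : (thetaIndex (pilotDataOfK D K)).Fibre (.inr pp)) {k ev l' : ℕ}
    (hp : 2 < (pp : ℕ))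
    (hram : haveI : Fact (pp : ℕ).Prime := ⟨pp.2⟩; (placeOf (pilotDataOfK D K) pp.1 w).asIdeal.ramificationIdx ℤ = ev * l')
    (htame : ¬ (pp : ℕ) ∣ ev * l') (hev : 1 ≤ ev)
    (hP : haveI : Fact (pp : ℕ).Prime := ⟨pp.2⟩; (pilotDataOfK D K).qPilot (placeOf (pilotDataOfK D K) pp.1 w) = (ev * k : ℕ))
    (hl : ∀ i₀ : Fin (thetaIndex (pilotDataOfK D K)).lstar, 2 * ((i₀ : ℕ) + 1) + 1 ≤ l')
    (hk : k ≤ 2 * (bWin pp (ev * l') + 2)) (i₀ : Fin (thetaIndex (pilotDataOfK D K)).lstar) :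
    haveI : Fact (pp : ℕ).Prime := ⟨pp.2⟩
    CellAt (pilotDataOfK D K) hlog pp i₀ w :=
  cellAt_pilotDataOfK_of_closedSuff D hlog pp i₀ w hp hram htame hP (closedSuff_of_k_le rfl rfl hev (hl i₀) hk)

end ClosedForm

/-! ## §4. Kernel evaluations at the §8 A6 slice boundary of I06STAR-COLUMNS v1 (λ_k rows: `p = 7`, `e = ev·l`, `m = ev·k`, top label `j = (l−1)/2`) -/

section Rows

/-- G-HEX-k7-l41-ev1 (`e = 41`, `m = 7`, `j = 20`, `B = 1`): the cell FAILS — the single failure of the slice `k ≤ 8` (127/128); seat-side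
margin `−55/41`. [folklore] -/
theorem intCell_k7_l41_ev1_top_false : ¬ IntCell 7 41 7 20 := by
  unfold IntCell aWin bWin; decide

/-- G-HEX-k8-l47-ev1 (`e = 47`, `m = 8`, `j = 23`, `B = 2`): the cell HOLDS (margin `501/47`). [folklore] -/
theorem intCell_k8_l47_ev1_top : IntCell 7 47 8 23 := by
  unfold IntCell aWin bWin; decide

/-- G-HEX-k9-l53-ev5 (`e = 265`, `m = 45`, `j = 26`, `B = 2`): the cell FAILS (margin `−247/265`). [folklore] -/
theorem intCell_k9_l53_ev5_top_false : ¬ IntCell 7 265 45 26 := by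
  unfold IntCell aWin bWin; decide

/-- G-HEX-k9-l53-ev6 (`e = 318`, `m = 54`, `j = 26`, `B = 3`): the cell HOLDS (margin `2765/106`) — `k = 9 ≤ 2·(3+2)`. [folklore] -/
theorem intCell_k9_l53_ev6_top : IntCell 7 318 54 26 := by
  unfold IntCell aWin bWin; decide

/-- The closed form at G-HEX-k8-l47-ev1: `ClosedSuff 7 47 8 23` (`22·8 + 2 = 178 ≤ 47·4 + 10 = 198`). [folklore] -/
theorem closedSuff_k8_l47_ev1_top : ClosedSuff 7 47 8 23 := by
  unfold ClosedSuff aWin bWin; decide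

variable {F K Fbar : Type} [Field F] [NumberField F] [Field K] [NumberField K] [Algebra F K] [Field Fbar]
  [Algebra F Fbar] [Algebra K Fbar] {E : WeierstrassCurve F} [E.IsElliptic] {l : ℕ} {Pb : BadPlacePredicates K}
  (D : InitialThetaData F K Fbar E l Pb) {logv : PadicLogs K} (hlog : LogvAnalytic logv)

/-- **GENUINE-DATUM COROLLARY at the slice's single failing row** (G-HEX-k7-l41-ev1): at a place `w | 7` of `pilotDataOfK D K` with `e(w|7) = 41`
and `P_q(w) = 7`, H⋆₃'s cell FAILS at the label `j = 20` (`i₀ = 19`); with `not_licence_of_not_cellAt` (p458118) this is the kernel form of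
R-W's «REFUTED-ED» at that row when `w` is bad. [claim: Mochizuki2012, status: disputed] -/
theorem not_cellAt_pilotDataOfK_k7_l41_ev1 (pp : Nat.Primes) (hpp : (pp : ℕ) = 7) (i₀ : Fin (thetaIndex (pilotDataOfK D K)).lstar)
    (hi : (i₀ : ℕ) = 19) (w : (thetaIndex (pilotDataOfK D K)).Fibre (.inr pp))
    (hram : haveI : Fact (pp : ℕ).Prime := ⟨pp.2⟩; (placeOf (pilotDataOfK D K) pp.1 w).asIdeal.ramificationIdx ℤ = 41)
    (hP : haveI : Fact (pp : ℕ).Prime := ⟨pp.2⟩; (pilotDataOfK D K).qPilot (placeOf (pilotDataOfK D K) pp.1 w) = 7) :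
    haveI : Fact (pp : ℕ).Prime := ⟨pp.2⟩
    ¬ CellAt (pilotDataOfK D K) hlog pp i₀ w := by
  rw [cellAt_pilotDataOfK_iff_intCell D hlog pp i₀ w (by omega) hram (by rw [hpp]; decide) hP, hi, hpp]
  exact intCell_k7_l41_ev1_top_false

end Rows

end Summit.ABC.IUTFork.Repair.RHHullCapacityNecessaryInt

end
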